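import Summits.CriticalPhenomena.PercolationContinuityZ3.Theorems.PercNearOneGluingNoHeavyQuantBlobLoadUnits
import Summits.CriticalPhenomena.PercolationContinuityZ3.Theorems.PercNearOneGluingNoHeavyQuantBinomialBlobsHeavy
import Summits.CriticalPhenomena.PercolationContinuityZ3.Theorems.PercNearOneGluingNoHeavyQuantThreeValuedReduction
import HarnessLib

/-!
# QUANT lane R8, T-DEC: the SINGLE-LOW CELLS of the Hoeffding reduction — `r` equal blobs at a lowered target `k·T'`, `0 < T' ≤ 2`, are heavy
# as soon as the zero atom is paid for by the top atoms at the floor gate (prim-quant-census-2 gen 83, file 5)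

builds on p205010 (kernel theorem, internal audit signed; external expert review pending)

Support file (`--supports stmt-CriticalPhenomena-4575`), QUANT lane census seat prim-quant-census-2 (gen 83); memo
`run/shared/lean/prim/quant/prim-quant-census-2-g83/HOEFFDING-G83.md`.  Theorems only, standard axioms, no sorries, no definitions.

By `heavy_blobLaw_of_binomialFamily` (`…QuantThreeValuedReduction`) conjecture BLOB-AFL for an arbitrary gate vector of width `n` reduces to the
cells "`r` equal blobs `(k,g)` heavy at floor `x = S/n`, target `k·(r·g − m)`", `m + r ≤ n`.  When `T' := r·g − m ≤ 2` the only low atom of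
that law is `0` (mass `(1−g)^r`), and the cheapest certificate pairs it with the admissible top atoms.  This file proves the FLOOR-GATE form of
that certificate, which is all the cells `g < 1/2` of widths `5, 6, 7` need (memo §2: their uniform-spreading loads are `≤ 0.66`):
* **`heavy_binomial_singleLow_floor`** — law `blobLaw (replicate r (k,g))`, floor `0 < x ≤ 1`, target `k·T'` with `0 < T' ≤ 2`, a threshold `J`
  with `T' < J` and `T' ≤ x·J` (so every atom `j·k`, `j ≥ J`, is admissible for the zero atom at the floor gate: credit `j·k·x ≥ k·T'`); if
  `x·P(0) ≤ (1 − x)·Σ_{J ≤ j ≤ r} P(j·k)` then the law is heavy at `(x, k·T')` on `{0..r·k}` (pairs `{0, j·k; x}`, `j ≥ J`, loaded uniformly;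
  via `heavy_of_pairWeights`).
* `sum_lattice_window` — the bookkeeping `Σ_{h ≤ r·k} [k ∣ h, J·k ≤ h]·μ h = Σ_{J ≤ j ≤ r} μ(j·k)`.

HONEST STATUS.  Tool for the cells; conjecture BLOB-AFL in the middle band beyond width 4, conjecture C, `SiblingStep`, `FarTreeRow`, `GluedLemmaW`,
`GluedDominatedMass` OPEN; RATE class (log\*) / honest sentence of `run/shared/lean/prim/quant/README.md` unchanged.  [this work].  Nothing here
is cited as a published result.  The gluing rows served [cite: KozmaNitzan2024, Conjecture 3 (p. 15)]; product measure [cite: Grimmett1999, §1.3 p. 10].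
-/

noncomputable section

open scoped BigOperators

namespace Summit.CriticalPhenomena.PercolationContinuityZ3.Theorems
namespace Quant

open Finset

/-- the two-point law `{lo, hi; g}` (as in `…QuantLawDEC`) -/
local notation3 "TP[" lo ", " hi ", " g ", " h "]" =>
  (g : ℝ) * (if (h : ℕ) = (hi : ℕ) then (1 : ℝ) else 0) + (1 - (g : ℝ)) * (if (h : ℕ) = (lo : ℕ) then (1 : ℝ) else 0)

/-- a HEAVY decomposition of the law `μ` on `{0..M}` at floor `x`, target `T` (the inline `∃` consumed by `decAtT_of_heavy`) -/
local notation3 "HEAVY[" x ", " T ", " M ", " μ "]" =>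
  ∃ (ι : Type) (_ : Fintype ι) (lam γ : ι → ℝ) (lo hi : ι → ℕ),
    (∀ i, 0 ≤ lam i) ∧ (∑ i, lam i = 1) ∧ (∀ i, 0 ≤ γ i ∧ γ i ≤ 1) ∧ (∀ i, lo i ≤ hi i) ∧ (∀ i, hi i ≤ (M : ℕ)) ∧
    (∀ h, (μ : ℕ → ℝ) h = ∑ i, lam i * TP[lo i, hi i, γ i, h]) ∧
    (∀ i, 0 < lam i → (x : ℝ) ≤ γ i ∧ (T : ℝ) ≤ 2 * (lo i : ℝ) + ((hi i : ℝ) - lo i) * γ i)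

namespace LawDec

/-- lattice bookkeeping: `Σ_{h ≤ r·k} [k ∣ h ∧ J·k ≤ h]·μ h = Σ_{J ≤ j ≤ r} μ(j·k)` (`k ≥ 1`). [folklore] -/
theorem sum_lattice_window (k r J : ℕ) (hk : 0 < k) (μ : ℕ → ℝ) :
    ∑ h ∈ Finset.range (r * k + 1), (if k ∣ h ∧ J * k ≤ h then μ h else 0)
      = ∑ j ∈ Finset.Ico J (r + 1), μ (j * k) := by
  rw [sum_range_mul_eq_sum_multiples k hk (fun h => if k ∣ h ∧ J * k ≤ h then μ h else 0)
    (fun l hl => by rw [if_neg (fun h => hl h.1)]) r]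
  have e : ∀ j ∈ Finset.range (r + 1),
      (if k ∣ j * k ∧ J * k ≤ j * k then μ (j * k) else 0) = (if J ≤ j then μ (j * k) else 0) := by
    intro j _
    by_cases hj : J ≤ j
    · rw [if_pos ⟨Dvd.intro_left j rfl, Nat.mul_le_mul_right k hj⟩, if_pos hj]
    · rw [if_neg (fun h => hj (Nat.le_of_mul_le_mul_right h.2 hk)), if_neg hj]
  rw [Finset.sum_congr rfl e, ← Finset.sum_filter]
  congr 1
  ext j
  simp only [Finset.mem_filter, Finset.mem_range, Finset.mem_Ico]
  omega

/-- **THE SINGLE-LOW CELL AT THE FLOOR GATE.**  See the file header. [this work] -/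
theorem heavy_binomial_singleLow_floor (k r J : ℕ) (hk : 0 < k) {g x T' : ℝ} (hg0 : 0 ≤ g) (hg1 : g ≤ 1)
    (hx0 : 0 < x) (hx1 : x ≤ 1) (hT0 : 0 < T') (hT2 : T' ≤ 2) (hJ : T' < J) (hJx : T' ≤ x * J)
    (hcap : x * blobLaw (List.replicate r (k, g)) 0
      ≤ (1 - x) * ∑ j ∈ Finset.Ico J (r + 1), blobLaw (List.replicate r (k, g)) (j * k)) :
    HEAVY[x, (k : ℝ) * T', r * k, blobLaw (List.replicate r (k, g))] := by
  classical
  set μ := blobLaw (List.replicate r (k, g)) with hμdef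
  have hk' : (0 : ℝ) < k := by exact_mod_cast hk
  have hgates : ∀ p ∈ List.replicate r (k, g), 0 ≤ p.2 ∧ p.2 ≤ 1 := fun p hp => by
    rw [List.eq_of_mem_replicate hp]; exact ⟨hg0, hg1⟩
  have hμ0 : ∀ h, 0 ≤ μ h := blobLaw_nonneg _ hgates
  have htop : blobTop (List.replicate r (k, g)) = r * k := blobTop_replicate r k g
  have hμM : ∀ h, r * k < h → μ h = 0 := fun h hh => blobLaw_eq_zero _ h (by rw [htop]; exact hh)
  have hμ1 : ∑ h ∈ Finset.range (r * k + 1), μ h = 1 := by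
    have h1 := sum_blobLaw (List.replicate r (k, g)); rwa [htop] at h1
  have hdvd : ∀ h, ¬ k ∣ h → μ h = 0 := fun h hh =>
    blobLaw_eq_zero_of_not_dvd k _ (fun p hp => by rw [List.eq_of_mem_replicate hp]) h hh
  -- the only low atom is `0`
  have hsl : ∀ h : ℕ, 0 < h → 2 * (h : ℝ) < (k : ℝ) * T' → μ h = 0 := by
    intro h hh0 hhT
    by_cases hd : k ∣ h
    · exfalso
      obtain ⟨j, rfl⟩ := hd
      have hj : 1 ≤ j := by
        rcases Nat.eq_zero_or_pos j with h0 | h0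
        · subst h0; simp at hh0
        · exact h0
      have : (k : ℝ) * 2 ≤ 2 * ((k * j : ℕ) : ℝ) := by
        push_cast
        have : (1 : ℝ) ≤ j := by exact_mod_cast hj
        nlinarith
      nlinarith
    · exact hdvd h hd
  -- capacity and the two cases
  set Cap := ∑ j ∈ Finset.Ico J (r + 1), μ (j * k) with hCap
  have hCap0 : 0 ≤ Cap := Finset.sum_nonneg fun j _ => hμ0 _
  rcases (hμ0 0).eq_or_lt with hz | hpos
  · -- no low mass at all: points
    refine heavy_points _ _ _ _ hx1 hμ0 hμM hμ1 fun h hh => ?_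
    by_contra hge
    have hlt : 2 * (h : ℝ) < (k : ℝ) * T' := lt_of_not_ge hge
    rcases Nat.eq_zero_or_pos h with h0 | h0
    · subst h0; rw [← hz] at hh; exact lt_irrefl _ hh
    · rw [hsl h h0 hlt] at hh; exact lt_irrefl _ hh
  -- `μ 0 > 0`: then `x < 1` and `Cap > 0`
  have hx1' : x < 1 := by
    by_contra hge
    have hxe : x = 1 := le_antisymm hx1 (not_lt.1 hge)
    rw [hxe, sub_self, zero_mul, one_mul] at hcap
    linarith
  have hCpos : 0 < Cap := by
    by_contra hle
    have hC0 : Cap = 0 := le_antisymm (not_lt.1 hle) hCap0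
    rw [hC0, mul_zero] at hcap
    nlinarith
  set c := μ 0 / ((1 - x) * Cap) with hc
  have h1x : 0 < 1 - x := by linarith
  have hc0 : 0 ≤ c := div_nonneg (hμ0 0) (mul_pos h1x hCpos).le
  have hcx : c * x ≤ 1 := by
    rw [hc, div_mul_eq_mul_div, div_le_one (mul_pos h1x hCpos)]
    linarith
  -- the weight table: pairs `{0, h; x}` for the lattice atoms `h ≥ J·k`
  let w : ℕ → ℕ → ℝ := fun l h => if l = 0 ∧ (k ∣ h ∧ J * k ≤ h) ∧ h ≤ r * k then c * μ h else 0
  refine heavy_of_pairWeights x ((k : ℝ) * T') (r * k) μ w (fun _ _ => x) hx0.le hx1 hμM hμ1 (fun l h => ?_) ?_ ?_ ?_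
  · -- nonnegative weights
    simp only [w]; split_ifs
    · exact mul_nonneg hc0 (hμ0 h)
    · exact le_rfl
  · -- support conditions
    intro l h hw
    simp only [w] at hw
    split_ifs at hw with hcond
    · obtain ⟨rfl, ⟨⟨j, rfl⟩, hJj⟩, hjr⟩ := hcond
      have hJj' : J ≤ j := Nat.le_of_mul_le_mul_right (by rwa [Nat.mul_comm k j] at hJj) hk
      have hj0 : 0 < j := by
        have : (0 : ℝ) < J := hT0.trans hJ
        have hJ0 : 0 < J := by exact_mod_cast this
        omega
      refine ⟨by simp only [Nat.cast_zero, mul_zero]; exact mul_pos hk' hT0, Nat.mul_pos hk hj0, hjr, le_rfl, hx1, ?_⟩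
      have hJj'' : (J : ℝ) ≤ j := by exact_mod_cast hJj'
      have h1 : (k : ℝ) * T' ≤ (k : ℝ) * (x * J) := mul_le_mul_of_nonneg_left hJx hk'.le
      have h2 : (k : ℝ) * (x * J) ≤ (k : ℝ) * (x * j) :=
        mul_le_mul_of_nonneg_left (mul_le_mul_of_nonneg_left hJj'' hx0.le) hk'.le
      push_cast
      linarith
    · exact absurd hw (lt_irrefl 0)
  · -- lows shipped exactly
    intro l hl hlow
    rcases Nat.eq_zero_or_pos l with rfl | hl0
    · have e : ∀ h ∈ Finset.range (r * k + 1), w 0 h * (1 - x) = (1 - x) * c * (if k ∣ h ∧ J * k ≤ h then μ h else 0) := by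
        intro h hh
        have hhr : h ≤ r * k := Nat.lt_succ_iff.1 (Finset.mem_range.1 hh)
        simp only [w, true_and]
        by_cases hcond : k ∣ h ∧ J * k ≤ h
        · rw [if_pos ⟨hcond, hhr⟩, if_pos hcond]; ring
        · rw [if_neg (fun h' => hcond h'.1), if_neg hcond]; ring
      rw [Finset.sum_congr rfl e, ← Finset.mul_sum, sum_lattice_window k r J hk μ, ← hCap, hc]
      field_simp
    · have hz : μ l = 0 := hsl l hl0 hlow
      rw [hz]
      refine Finset.sum_eq_zero fun h _ => ?_
      simp only [w]
      rw [if_neg (fun h' => (Nat.pos_iff_ne_zero.1 hl0) h'.1), zero_mul]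
  · -- highs loaded by at most their mass
    intro h hh _
    rw [Finset.sum_eq_single 0]
    · simp only [w, true_and]
      split_ifs
      · calc c * μ h * x = (c * x) * μ h := by ring
          _ ≤ 1 * μ h := mul_le_mul_of_nonneg_right hcx (hμ0 h)
          _ = μ h := one_mul _
      · rw [zero_mul]; exact hμ0 h
    · intro l _ hl
      simp only [w]
      rw [if_neg (fun h' => hl h'.1), zero_mul]
    · intro h0; exact absurd (Finset.mem_range.2 (Nat.succ_pos _)) h0

end LawDec
end Quant
end Summit.CriticalPhenomena.PercolationContinuityZ3.Theorems
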